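import Literature.AlgebraicGeometry.Resolution.Alterations
import Literature.AlgebraicGeometry.Motives.SegreEmbedding
import Mathlib.AlgebraicGeometry.Morphisms.Separated
import HarnessLib

/-!
# Base change over opens, projectivity of fibre products, isomorphisms as alterations

Topic: `Literature/AlgebraicGeometry/Resolution`. Bookkeeping for the base-change steps of
de Jong 1996 (4.15: "`X' ⊂ Y' ×_Y X`"; 4.22: "Pulling back the family `𝒞` to a family `𝒳` over
`Y'` and applying 4.4 once again"), all proved and stated for Mathlib's fibre product
`pullback f ψ` of `f : X → Y` and `ψ : Y' → Y` (`fst : X ×_Y Y' → X`, `snd : X ×_Y Y' → Y'`):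

* for a morphism property `P` stable under base change — `P (ψ ∣_ U) → P (fst ∣_ f⁻¹U)`,
  `P (f ∣_ U) → P (snd ∣_ ψ⁻¹U)` (restrictions over an open `U ⊆ Y`), `P (U.ι ≫ f) →
  P ((fst⁻¹ U).ι ≫ snd)` (an open `U ⊆ X`), `P (V.ι ≫ ψ) → P ((snd⁻¹ V).ι ≫ fst)` (an open
  `V ⊆ Y'`): the relevant squares are cartesian (`isPullback_morphismRestrict` pasted with the
  defining square); used with `P` = finite, smooth, étale;
* closed subschemes of projective `k`-schemes are projective, and `X ×_Y Y'` is projective over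
  `k` when `X`, `Y'` are and `Y → Spec k` is separated — it is a closed subscheme (Mathlib's
  `pullback.mapDesc`, a base change of the diagonal of `Y`) of `X ×_k Y'`, projective by the
  Segre embedding (`Literature.AlgebraicGeometry.Motives.IsProjectiveOver.tensor`);
* an isomorphism between integral schemes is an alteration (2.20).

## Sources

* A. J. de Jong, *Smoothness, semi-stability and alterations*, Publ. Math. IHÉS 83 (1996), 2.20
  (p. 61), 4.15 (p. 71), 4.22 (p. 75).
* R. Hartshorne, *Algebraic Geometry* (1977), II Ex. 3.11 (a), II Ex. 4.9 (closed immersions and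
  projectivity under products).
-/

noncomputable section

open CategoryTheory CategoryTheory.Limits AlgebraicGeometry TopologicalSpace Topology

namespace Literature.AlgebraicGeometry.Resolution

universe u

/-! ## Base change of morphism properties over opens and along composites

For a cartesian square `X ×_Y Y'` (Mathlib's `pullback f ψ`, `fst : X ×_Y Y' → X`,
`snd : X ×_Y Y' → Y'`) and a property `P` stable under base change: `P` of `ψ` over an open
`U ⊆ Y` gives `P` of `fst` over `f⁻¹(U)`; `P` of `f` over `U` gives `P` of `snd` over `ψ⁻¹(U)`;
`P` of `U.ι ≫ f` gives `P` of `(fst⁻¹ U).ι ≫ snd`; `P` of `V.ι ≫ ψ` gives `P` of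
`(snd⁻¹ V).ι ≫ fst`. -/

section BaseChangeOpens

variable {P : MorphismProperty Scheme.{u}} [P.IsStableUnderBaseChange] {X Y Y' : Scheme.{u}}
  (f : X ⟶ Y) (ψ : Y' ⟶ Y)

/-- If `ψ : Y' → Y` has `P` over the open `U ⊆ Y` then its base change `X ×_Y Y' → X` has `P`
over `f⁻¹(U)` (`P` stable under base change). [folklore] -/
theorem morphismRestrict_pullback_fst_of_morphismRestrict (U : Y.Opens) (hψ : P (ψ ∣_ U)) :
    P (pullback.fst f ψ ∣_ f ⁻¹ᵁ U) := by
  set π := pullback.fst f ψ with hπ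
  -- the lift of `(π⁻¹ f⁻¹ U).ι ≫ snd` through `ψ⁻¹ U`
  have hrange : Set.range ((π ⁻¹ᵁ (f ⁻¹ᵁ U)).ι ≫ pullback.snd f ψ) ⊆
      Set.range (ψ ⁻¹ᵁ U).ι := by
    rintro _ ⟨x, rfl⟩
    rw [Scheme.Opens.range_ι]
    show ψ (pullback.snd f ψ ((π ⁻¹ᵁ (f ⁻¹ᵁ U)).ι x)) ∈ U
    rw [← Scheme.Hom.comp_apply, ← pullback.condition, Scheme.Hom.comp_apply]
    exact x.2
  let l := IsOpenImmersion.lift (ψ ⁻¹ᵁ U).ι _ hrange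
  have hl : l ≫ (ψ ⁻¹ᵁ U).ι = (π ⁻¹ᵁ (f ⁻¹ᵁ U)).ι ≫ pullback.snd f ψ :=
    IsOpenImmersion.lift_fac _ _ _
  have big : IsPullback (π ∣_ f ⁻¹ᵁ U) (l ≫ (ψ ⁻¹ᵁ U).ι) ((f ∣_ U) ≫ U.ι) ψ := by
    rw [hl, morphismRestrict_ι]
    exact (isPullback_morphismRestrict π (f ⁻¹ᵁ U)).paste_vert (IsPullback.of_hasPullback f ψ)
  have e : (π ∣_ f ⁻¹ᵁ U) ≫ (f ∣_ U) = l ≫ (ψ ∣_ U) := by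
    rw [← cancel_mono U.ι, Category.assoc, Category.assoc, morphismRestrict_ι,
      morphismRestrict_ι_assoc, morphismRestrict_ι, reassoc_of% hl, ← pullback.condition]
  have sq : IsPullback (π ∣_ f ⁻¹ᵁ U) l (f ∣_ U) (ψ ∣_ U) :=
    (IsPullback.paste_vert_iff (isPullback_morphismRestrict ψ U) e).mp big
  exact P.of_isPullback sq.flip hψ

/-- If `f : X → Y` has `P` over the open `U ⊆ Y` then its base change `X ×_Y Y' → Y'` has `P`
over `ψ⁻¹(U)`. [folklore] -/
theorem morphismRestrict_pullback_snd_of_morphismRestrict (U : Y.Opens) (hf : P (f ∣_ U)) :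
    P (pullback.snd f ψ ∣_ ψ ⁻¹ᵁ U) := by
  set ρ := pullback.snd f ψ with hρ
  have hrange : Set.range ((ρ ⁻¹ᵁ (ψ ⁻¹ᵁ U)).ι ≫ pullback.fst f ψ) ⊆
      Set.range (f ⁻¹ᵁ U).ι := by
    rintro _ ⟨x, rfl⟩
    rw [Scheme.Opens.range_ι]
    show f (pullback.fst f ψ ((ρ ⁻¹ᵁ (ψ ⁻¹ᵁ U)).ι x)) ∈ U
    rw [← Scheme.Hom.comp_apply, pullback.condition, Scheme.Hom.comp_apply]
    exact x.2
  let l := IsOpenImmersion.lift (f ⁻¹ᵁ U).ι _ hrange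
  have hl : l ≫ (f ⁻¹ᵁ U).ι = (ρ ⁻¹ᵁ (ψ ⁻¹ᵁ U)).ι ≫ pullback.fst f ψ :=
    IsOpenImmersion.lift_fac _ _ _
  have big : IsPullback (ρ ∣_ ψ ⁻¹ᵁ U) (l ≫ (f ⁻¹ᵁ U).ι) ((ψ ∣_ U) ≫ U.ι) f := by
    rw [hl, morphismRestrict_ι]
    exact (isPullback_morphismRestrict ρ (ψ ⁻¹ᵁ U)).paste_vert
      (IsPullback.of_hasPullback f ψ).flip
  have e : (ρ ∣_ ψ ⁻¹ᵁ U) ≫ (ψ ∣_ U) = l ≫ (f ∣_ U) := by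
    rw [← cancel_mono U.ι, Category.assoc, Category.assoc, morphismRestrict_ι,
      morphismRestrict_ι_assoc, morphismRestrict_ι, reassoc_of% hl, pullback.condition]
  have sq : IsPullback (ρ ∣_ ψ ⁻¹ᵁ U) l (ψ ∣_ U) (f ∣_ U) :=
    (IsPullback.paste_vert_iff (isPullback_morphismRestrict f U) e).mp big
  exact P.of_isPullback sq.flip hf

/-- If `U.ι ≫ f : U → Y` has `P` for an open `U ⊆ X` then `(fst⁻¹ U).ι ≫ snd : fst⁻¹(U) → Y'`
has `P` (it is a base change of the former along `ψ`). [folklore] -/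
theorem ι_comp_pullback_snd_of_ι_comp (U : X.Opens) (hf : P (U.ι ≫ f)) :
    P ((pullback.fst f ψ ⁻¹ᵁ U).ι ≫ pullback.snd f ψ) := by
  have sq : IsPullback ((pullback.fst f ψ ⁻¹ᵁ U).ι ≫ pullback.snd f ψ)
      (pullback.fst f ψ ∣_ U) ψ (U.ι ≫ f) :=
    (isPullback_morphismRestrict (pullback.fst f ψ) U).flip.paste_horiz
      (IsPullback.of_hasPullback f ψ).flip
  exact P.of_isPullback sq.flip hf

/-- If `V.ι ≫ ψ : V → Y` has `P` for an open `V ⊆ Y'` then `(snd⁻¹ V).ι ≫ fst : snd⁻¹(V) → X`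
has `P` (it is a base change of the former along `f`). [folklore] -/
theorem ι_comp_pullback_fst_of_ι_comp (V : Y'.Opens) (hψ : P (V.ι ≫ ψ)) :
    P ((pullback.snd f ψ ⁻¹ᵁ V).ι ≫ pullback.fst f ψ) := by
  have sq : IsPullback ((pullback.snd f ψ ⁻¹ᵁ V).ι ≫ pullback.fst f ψ)
      (pullback.snd f ψ ∣_ V) f (V.ι ≫ ψ) :=
    (isPullback_morphismRestrict (pullback.snd f ψ) V).flip.paste_horiz
      (IsPullback.of_hasPullback f ψ)
  exact P.of_isPullback sq.flip hψ

end BaseChangeOpens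

/-! ## Projectivity of closed subschemes and of fibre products -/

/-- Closed subschemes of projective `k`-schemes are projective (compose the closed immersions).
[folklore] -/
theorem isProjectiveOver_of_isClosedImmersion_left {k : Type u} [Field k]
    {X Y : Motives.SchemeOver k} (ι : X ⟶ Y) [IsClosedImmersion ι.left]
    (h : Motives.IsProjectiveOver Y) :
    Motives.IsProjectiveOver X := by
  obtain ⟨n, κ, hκ⟩ := h
  haveI := hκ
  exact ⟨n, ι ≫ κ, inferInstanceAs (IsClosedImmersion (ι.left ≫ κ.left))⟩

open MonoidalCategory in
/-- **Base change of projective schemes**: if `X → Y → Spec k` and `Y' → Spec k` are projective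
and `Y → Spec k` is separated, then `X ×_Y Y'` is projective over `k` — it is a closed subscheme
(`Y` separated) of `X ×_k Y'`, which is projective by the Segre embedding
(`IsProjectiveOver.tensor`). [folklore] -/
theorem isProjectiveOver_pullback {k : Type u} [Field k] {X Y Y' : Scheme.{u}} (f : X ⟶ Y)
    (g : Y ⟶ Spec (.of k)) (ψ : Y' ⟶ Y) (g' : Y' ⟶ Spec (.of k)) (hψ : ψ ≫ g = g')
    [IsSeparated g]
    (hX : Motives.IsProjectiveOver (Over.mk (f ≫ g)))
    (hY' : Motives.IsProjectiveOver (Over.mk g')) :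
    Motives.IsProjectiveOver (Over.mk (pullback.snd f ψ ≫ g')) := by
  subst hψ
  let T : Motives.SchemeOver k := Over.mk (f ≫ g) ⊗ Over.mk (ψ ≫ g)
  have hT : Motives.IsProjectiveOver T := hX.tensor hY'
  have hw : pullback.mapDesc f ψ g ≫ T.hom =
      (Over.mk (pullback.snd f ψ ≫ ψ ≫ g) : Motives.SchemeOver k).hom := by
    show pullback.mapDesc f ψ g ≫ pullback.fst (f ≫ g) (ψ ≫ g) ≫ f ≫ g = pullback.snd f ψ ≫ ψ ≫ g
    rw [pullback.lift_fst_assoc, Category.comp_id, pullback.condition_assoc]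
  let ι : (Over.mk (pullback.snd f ψ ≫ ψ ≫ g) : Motives.SchemeOver k) ⟶ T :=
    Over.homMk (pullback.mapDesc f ψ g) hw
  haveI : IsClosedImmersion ι.left := inferInstanceAs (IsClosedImmersion (pullback.mapDesc f ψ g))
  exact isProjectiveOver_of_isClosedImmersion_left ι hT

/-! ## Alterations: isomorphisms -/

/-- An isomorphism onto an integral scheme from an integral scheme is an alteration. [folklore] -/
theorem isAlteration_of_isIso {X' X : Scheme.{u}} (e : X' ⟶ X) [IsIso e] [IsIntegral X'] :
    IsAlteration e where
  isIntegral := inferInstance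
  isProper := inferInstance
  isDominant := inferInstance
  exists_isFinite := ⟨⊤, ⟨e (Classical.arbitrary X'), trivial⟩, inferInstance⟩

end Literature.AlgebraicGeometry.Resolution

end
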